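import Summits.QuantumFields.YangMills.Theorems.BalabanLadderNTBoundaryLawClustering
import HarnessLib

/-!
# Crux `NT` (stmt-QuantumFields-19353), stub `stub_cfpw : CFPW`: nested law of total covariance and the enlarged collar

Helper file (`--supports stmt-QuantumFields-19353`) of the fleet lead prover of crux `NT` (unit `ym-spine-19353-p1`,
g3); tools for the companion file `…NTWeakPackageCover` (the two-point floor clause (F) of the registered stub
`stub_cfpw : CFPW`, skeleton v3 «weak-package» 374f16092bb0c203, on a covering set of radii):

* `kerCov_ge_of_nested` — **law of total covariance through a nested sub-cube, as a floor**: for cubes `Q₀ ⊆ Q`, if the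
  `Q₀`-conditional covariance of `F, G'` is `≥ m` for every exterior and the `Q₀`-kernel means of `F`, `G'` are within
  `h`, `h'` of constants, then `kerCov_{Q,η}(F, G') ≥ m − 4 h h'` for every exterior `η` of `Q` (DLR consistency
  `BoundaryLaw.kerE_kerE_of_subset` + the tree's `sub_mul_mul_le_cov_of_kernel`; Georgii 2011 Def. 1.23 (iii));
* `cubeEdges_xcentred_subset`, `depth_xcentred_ge` — nesting of x-centred cubes, depth `≥ R₀ + 1 − ‖y−x‖`;
* the ENLARGED COLLAR `κ(s) = (max 0 (A / Γ(s ∧ ℓ₂)))^{1/8}` at which a boundary-law term `4 (C₁/d⁴)²` is half a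
  two-point signal `c₂ Γ/ν⁸` (`A = 8C₁²/c₂`): `eight_mul_sq_le_collar` (absorption), `tendsto_mul_collar`
  (`s κ(s) → 0` from the growth clause `Γ(s)/s⁸ → ∞` — this is what the growth clause of (F) is for),
  `antitoneOn_collar` (antitone when `Γ` is positive and monotone on `(0, ℓ₂]`).
-/

set_option autoImplicit false

noncomputable section

open MeasureTheory Filter Topology
open Literature.MathematicalPhysics.QuantumFieldTheory Literature.MathematicalPhysics.QuantumLattice
open Literature.Probability.LatticeModels
open Summit.QuantumFields.YangMills.Cruxes.OSLegsFromFemtoAndGap.DlrCollarTransfer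
open Summit.QuantumFields.YangMills.Cruxes.OSLegsFromFemtoAndGap.DlrCollarTransfer.StubLower
  (exists_abs_dens_le le_depth_cube)
open Summit.QuantumFields.YangMills.Theorems.OSLegsFromFemtoAndGap.StubLower (sub_mul_mul_le_cov_of_kernel abs_apply_le_norm)
open Summit.QuantumFields.YangMills.Cruxes.NT.BoundaryLaw
  (cubeSites_subset cubeEdges_subset kerE_kerE_of_subset abs_kerE_le)

namespace Summit.QuantumFields.YangMills.Cruxes.NT.WeakPackage

/-! ## §1 Law of total covariance through a nested sub-cube, as a floor -/

section Kernel

variable (G : Type) [Group G] [TopologicalSpace G] [IsTopologicalGroup G] [CompactSpace G]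
  [MeasurableSpace G] [BorelSpace G] (r : LatticeRep G)

/-- **Law of total covariance through a nested sub-cube (floor form).**  For nested cubes `Q₀ ⊆ Q` (interior links),
bounded continuous observables `F, G'`, and every exterior `η` of `Q`: if for EVERY exterior `ζ` the `Q₀`-conditional
covariance `kerCov_{Q₀,ζ}(F, G') ≥ m` and the `Q₀`-kernel means satisfy `|kerE_{Q₀,ζ} F − p| ≤ h`,
`|kerE_{Q₀,ζ} G' − q| ≤ h'`, then `kerCov_{Q,η}(F, G') ≥ m − 4 h h'`.  (Consistency makes the `Q`-kernel means of
`F G'`, `F`, `G'` the `γ_Q(·|η)`-means of the corresponding `Q₀`-kernel means; then the tree's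
`sub_mul_mul_le_cov_of_kernel`.) [folklore] -/
theorem kerCov_ge_of_nested (β : ℝ) {c c₀ : Fin 4 → ℤ} {b b₀ : ℕ} (hsub : cubeEdges c₀ b₀ ⊆ cubeEdges c b)
    (η : LGConfig 4 G) {F G' : LGConfig 4 G → ℝ} (hFc : Continuous F) (hGc : Continuous G') {MF MG : ℝ}
    (hMF : ∀ U, |F U| ≤ MF) (hMG : ∀ U, |G' U| ≤ MG) {p q h h' m : ℝ}
    (hdF : ∀ ζ, |kerE G r β c₀ b₀ ζ F - p| ≤ h) (hdG : ∀ ζ, |kerE G r β c₀ b₀ ζ G' - q| ≤ h')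
    (hfl : ∀ ζ, m ≤ kerCov G r β c₀ b₀ ζ F G') :
    m - 4 * h * h' ≤ kerCov G r β c b η F G' := by
  haveI := r.secondCountableTopology
  haveI := isProbabilityMeasure_ymSpecification r.ρ r.continuous β (cubeEdges c b) η
  have hMF0 : 0 ≤ MF := (abs_nonneg _).trans (hMF (fun _ => 1))
  have hFG : Continuous fun U => F U * G' U := hFc.mul hGc
  have hFGb : ∀ U, |F U * G' U| ≤ MF * MG := fun U => by
    rw [abs_mul]; exact mul_le_mul (hMF U) (hMG U) (abs_nonneg _) hMF0
  -- the three `Q₀`-kernel means as continuous functions of the exterior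
  have hfc : Continuous fun ζ => kerE G r β c₀ b₀ ζ F := by
    unfold kerE; exact continuous_integral_ymSpecification r.ρ r.continuous β _ hFc hMF
  have hgc : Continuous fun ζ => kerE G r β c₀ b₀ ζ G' := by
    unfold kerE; exact continuous_integral_ymSpecification r.ρ r.continuous β _ hGc hMG
  have hfgc : Continuous fun ζ => kerE G r β c₀ b₀ ζ (fun U => F U * G' U) := by
    unfold kerE; exact continuous_integral_ymSpecification r.ρ r.continuous β _ hFG hFGb
  -- consistency: `Q`-means are `Q`-means of `Q₀`-means
  have hEFG : kerE G r β c b η (fun U => F U * G' U) =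
      kerE G r β c b η (fun ζ => kerE G r β c₀ b₀ ζ (fun U => F U * G' U)) :=
    (kerE_kerE_of_subset G r β hsub η hFG.measurable hFGb).symm
  have hEF : kerE G r β c b η F = kerE G r β c b η (fun ζ => kerE G r β c₀ b₀ ζ F) :=
    (kerE_kerE_of_subset G r β hsub η hFc.measurable hMF).symm
  have hEG : kerE G r β c b η G' = kerE G r β c b η (fun ζ => kerE G r β c₀ b₀ ζ G') :=
    (kerE_kerE_of_subset G r β hsub η hGc.measurable hMG).symm
  have key := sub_mul_mul_le_cov_of_kernel (μ := ymSpecification (d := 4) r.ρ β (cubeEdges c b) η)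
    (gA := fun ζ => kerE G r β c₀ b₀ ζ F) (gB := fun ζ => kerE G r β c₀ b₀ ζ G')
    (gAB := fun ζ => kerE G r β c₀ b₀ ζ (fun U => F U * G' U)) hfc hgc hfgc hdF hdG
    (fun ζ => by simpa only [kerCov] using hfl ζ)
  unfold kerCov
  rw [hEFG, hEF, hEG]
  simpa only [kerE] using key

end Kernel

/-! ## §2 Geometry of x-centred cubes -/

section Geometry

/-- x-centred cubes are nested: radius `R₀ ≤ R`. [folklore] -/
theorem cubeEdges_xcentred_subset (x : Fin 4 → ℤ) {R₀ R : ℕ} (h : R₀ ≤ R) :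
    cubeEdges (fun j => x j - R₀) (2 * R₀ + 1) ⊆ cubeEdges (fun j => x j - R) (2 * R + 1) :=
  cubeEdges_subset (cubeSites_subset fun j => ⟨by omega, by push_cast; omega⟩)

/-- Depth of `y` in the cube of radius `R₀` around `x`: at least `R₀ + 1 − ‖y − x‖`. [folklore] -/
theorem depth_xcentred_ge (x y : Fin 4 → ℤ) (R₀ : ℕ) :
    (R₀ : ℝ) + 1 - ‖siteToE (y - x)‖ ≤ (depth (fun j => x j - R₀) (2 * R₀ + 1) y : ℝ) :=
  le_depth_cube x y R₀ fun j => by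
    have := abs_apply_le_norm (siteToE (y - x)) j
    rwa [siteToE_apply, Pi.sub_apply, Int.cast_sub] at this

end Geometry

/-! ## §3 The enlarged collar: absorption, growth, antitonicity -/

section Collar

/-- **Absorption.**  With `κ = (max 0 (8 C₁²/(c₂ Γs)))^{1/8}` and `Γs > 0`, `c₂ > 0`:
`8 C₁² ≤ c₂ Γs (1 + κ)⁸` — so a boundary term `4 (C₁/((1+κ) ν)⁴)²` is at most half the signal `c₂ Γs / ν⁸`.
[folklore] -/
theorem eight_mul_sq_le_collar {C₁ c₂ Γs : ℝ} (hc₂ : 0 < c₂) (hΓ : 0 < Γs) :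
    8 * C₁ ^ 2 ≤ c₂ * Γs * (1 + (max 0 (8 * C₁ ^ 2 / (c₂ * Γs))) ^ ((8 : ℕ) : ℝ)⁻¹) ^ 8 := by
  set A : ℝ := max 0 (8 * C₁ ^ 2 / (c₂ * Γs)) with hA
  have hA0 : 0 ≤ A := le_max_left _ _
  have hκ0 : 0 ≤ A ^ ((8 : ℕ) : ℝ)⁻¹ := Real.rpow_nonneg hA0 _
  have hκ8 : (A ^ ((8 : ℕ) : ℝ)⁻¹) ^ 8 = A := Real.rpow_inv_natCast_pow hA0 (by norm_num)
  have h1 : A ≤ (1 + A ^ ((8 : ℕ) : ℝ)⁻¹) ^ 8 := by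
    calc A = (A ^ ((8 : ℕ) : ℝ)⁻¹) ^ 8 := hκ8.symm
      _ ≤ (1 + A ^ ((8 : ℕ) : ℝ)⁻¹) ^ 8 := pow_le_pow_left₀ hκ0 (by linarith) 8
  have h2 : 8 * C₁ ^ 2 / (c₂ * Γs) ≤ A := le_max_right _ _
  have hcΓ : 0 < c₂ * Γs := mul_pos hc₂ hΓ
  calc 8 * C₁ ^ 2 = c₂ * Γs * (8 * C₁ ^ 2 / (c₂ * Γs)) := by field_simp
    _ ≤ c₂ * Γs * A := mul_le_mul_of_nonneg_left h2 hcΓ.le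
    _ ≤ c₂ * Γs * (1 + A ^ ((8 : ℕ) : ℝ)⁻¹) ^ 8 := mul_le_mul_of_nonneg_left h1 hcΓ.le

/-- **Growth makes the enlarged collar admissible**: if `Γ(s)/s⁸ → ∞` as `s → 0⁺` then
`s · (max 0 (A / Γ(s ∧ ℓ₂)))^{1/8} → 0` (`A ≥ 0`, `ℓ₂ > 0`): indeed it equals `(A / (Γ(s)/s⁸))^{1/8}` for small `s`.
[folklore] -/
theorem tendsto_mul_collar {Γ : ℝ → ℝ} {A ℓ₂ : ℝ} (hA : 0 ≤ A) (hℓ₂ : 0 < ℓ₂)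
    (hΓlim : Tendsto (fun s : ℝ => Γ s / s ^ 8) (nhdsWithin 0 (Set.Ioi 0)) atTop) :
    Tendsto (fun s : ℝ => s * (max 0 (A / Γ (min s ℓ₂))) ^ ((8 : ℕ) : ℝ)⁻¹)
      (nhdsWithin 0 (Set.Ioi 0)) (nhds 0) := by
  -- `g s = A / (Γ s / s⁸) → 0`
  have hg : Tendsto (fun s : ℝ => A * (Γ s / s ^ 8)⁻¹) (nhdsWithin 0 (Set.Ioi 0)) (nhds 0) := by
    have := (tendsto_inv_atTop_zero.comp hΓlim).const_mul A
    simpa using this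
  -- `u ↦ u^{1/8}` is continuous at `0`
  have hroot : Tendsto (fun u : ℝ => u ^ ((8 : ℕ) : ℝ)⁻¹) (nhds 0) (nhds 0) := by
    have hc := (Real.continuousAt_rpow_const 0 (((8 : ℕ) : ℝ)⁻¹) (Or.inr (by positivity))).tendsto
    rwa [Real.zero_rpow (by positivity)] at hc
  have hcomp := hroot.comp hg
  -- eventual equality with the collar expression
  have hev1 : ∀ᶠ s in nhdsWithin (0 : ℝ) (Set.Ioi 0), 1 ≤ Γ s / s ^ 8 := hΓlim.eventually_ge_atTop 1
  have hev2 : ∀ᶠ s in nhdsWithin (0 : ℝ) (Set.Ioi 0), s ∈ Set.Ioi (0 : ℝ) := self_mem_nhdsWithin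
  have hev3 : ∀ᶠ s in nhdsWithin (0 : ℝ) (Set.Ioi 0), s < ℓ₂ :=
    mem_nhdsWithin_of_mem_nhds (Iio_mem_nhds hℓ₂)
  refine hcomp.congr' ?_
  filter_upwards [hev1, hev2, hev3] with s h1 h2 h3
  have hs : 0 < s := h2
  have hs8 : 0 < s ^ 8 := by positivity
  have hΓs : 0 < Γ s := by
    have : 0 < Γ s / s ^ 8 := lt_of_lt_of_le one_pos h1
    exact (div_pos_iff_of_pos_right hs8).1 this
  have hmin : min s ℓ₂ = s := min_eq_left h3.le
  have hmax : max 0 (A / Γ s) = A / Γ s := max_eq_right (div_nonneg hA hΓs.le)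
  simp only [Function.comp_apply]
  rw [hmin, hmax]
  have hsroot : (s ^ 8) ^ ((8 : ℕ) : ℝ)⁻¹ = s := Real.pow_rpow_inv_natCast hs.le (by norm_num)
  rw [show (A * (Γ s / s ^ 8)⁻¹) = s ^ 8 * (A / Γ s) by field_simp,
    Real.mul_rpow hs8.le (div_nonneg hA hΓs.le), hsroot]

/-- **The enlarged collar is antitone** when `Γ` is positive and monotone on `(0, ℓ₂]` (`A ≥ 0`). [folklore] -/
theorem antitoneOn_collar {Γ : ℝ → ℝ} {A ℓ₂ : ℝ} (hA : 0 ≤ A) (hℓ₂ : 0 < ℓ₂)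
    (hΓpos : ∀ s : ℝ, 0 < s → s ≤ ℓ₂ → 0 < Γ s) (hΓmono : MonotoneOn Γ (Set.Ioc 0 ℓ₂)) :
    AntitoneOn (fun s : ℝ => (max 0 (A / Γ (min s ℓ₂))) ^ ((8 : ℕ) : ℝ)⁻¹) (Set.Ioi 0) := by
  intro s hs t ht hst
  have hs' : 0 < s := hs
  have ht' : 0 < t := ht
  have hms : min s ℓ₂ ∈ Set.Ioc 0 ℓ₂ := ⟨lt_min hs' hℓ₂, min_le_right _ _⟩
  have hmt : min t ℓ₂ ∈ Set.Ioc 0 ℓ₂ := ⟨lt_min ht' hℓ₂, min_le_right _ _⟩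
  have hle : Γ (min s ℓ₂) ≤ Γ (min t ℓ₂) := hΓmono hms hmt (min_le_min hst le_rfl)
  have hps : 0 < Γ (min s ℓ₂) := hΓpos _ hms.1 hms.2
  have hdiv : A / Γ (min t ℓ₂) ≤ A / Γ (min s ℓ₂) := div_le_div_of_nonneg_left hA hps hle
  exact Real.rpow_le_rpow (le_max_left _ _) (max_le_max le_rfl hdiv) (by positivity)

end Collar

end Summit.QuantumFields.YangMills.Cruxes.NT.WeakPackage

end
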